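import Mathlib
import Summits.KontsevichZagierPeriods.Zeta5Search.CatalanRemarksTSeries
import Summits.KontsevichZagierPeriods.Zeta5Search.CatalanRemarksTInclusions
import HarnessLib

/-!
# Zudilin 2002 [Zu02c], Theorem 2: the named fact `remarksTheorem2` reduced to its two asymptotic clauses

Source: W. Zudilin, *A few remarks on linear forms involving Catalan's constant*, arXiv:math/0210423
[Zudilin2002CatalanRemarks], Sect. 2, Theorem 2.  HONEST FRAMING (cell `pub-zeta5`): systematic search; no
irrationality claim unless certified.  With clause (i) (`remarksTheorem2_clause_i`, file `CatalanRemarksTSeries`)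
and clause (iii) (`remarksTheorem2_inclusions`, file `CatalanRemarksTInclusions`: the inclusions (14) with exponent
exactly `4n`) proved, the Literature NAMED FACT `Zudilin2003.remarksTheorem2` is EQUIVALENT to the conjunction of
its asymptotic clauses (ii) `|ũ_nG − ṽ_n|^{1/n} → ((√5−1)/2)⁵` and (ii′) `ũ_n^{1/n} → ((1+√5)/2)⁵`
(`remarksTheorem2_iff_limits`); those (Poincaré–Perron asymptotics of the recursion (13)) are NOT addressed here.
-/

open Filter Real
open scoped Topology

namespace Summit.KontsevichZagierPeriods.Zeta5Search.CatalanRemarksVT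

open Literature.NumberTheory.Irrationality.Zudilin2003

/-- **`remarksTheorem2` from its asymptotic clauses alone**: (ii) and (ii′) imply the named fact, clauses (i) and
(iii) being theorems (`remarksTheorem2_clause_i`, `remarksTheorem2_inclusions`).
[cite: Zudilin2002CatalanRemarks, Sect. 2, Theorem 2] -/
theorem remarksTheorem2_of_limits
    (h₂ : Tendsto (fun n : ℕ => |formT n| ^ (1 / (n : ℝ))) atTop (𝓝 (((Real.sqrt 5 - 1) / 2) ^ 5)))
    (h₃ : Tendsto (fun n : ℕ => ((uT n : ℚ) : ℝ) ^ (1 / (n : ℝ))) atTop (𝓝 (((1 + Real.sqrt 5) / 2) ^ 5))) :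
    remarksTheorem2 :=
  remarksTheorem2_of_limits_of_inclusions h₂ h₃ remarksTheorem2_inclusions

/-- **The named fact `Zudilin2003.remarksTheorem2` is equivalent to the conjunction of its asymptotic clauses
(ii), (ii′).** [cite: Zudilin2002CatalanRemarks, Sect. 2, Theorem 2] -/
theorem remarksTheorem2_iff_limits :
    remarksTheorem2 ↔
      (Tendsto (fun n : ℕ => |formT n| ^ (1 / (n : ℝ))) atTop (𝓝 (((Real.sqrt 5 - 1) / 2) ^ 5))
        ∧ Tendsto (fun n : ℕ => ((uT n : ℚ) : ℝ) ^ (1 / (n : ℝ))) atTop (𝓝 (((1 + Real.sqrt 5) / 2) ^ 5))) :=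
  ⟨fun h => ⟨h.2.1, h.2.2.1⟩, fun h => remarksTheorem2_of_limits h.1 h.2⟩

end Summit.KontsevichZagierPeriods.Zeta5Search.CatalanRemarksVT
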